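import Summits.AtomisticToContinuum.Crystallization.Theorems.ThreeConeCertificateSlackRigidityPricedFloorsLayerEnergy
import Summits.AtomisticToContinuum.Crystallization.Theorems.ThreeConeCertificateSlackRigidityPricedFloorsIncrIdent1
import Summits.AtomisticToContinuum.Crystallization.Theorems.ThreeConeCertificateSlackRigidityPricedFloorsWindow
import HarnessLib

/-!
# `SlackRigidity` (stmt-AtomisticToContinuum-11960), line `priced-floors-palm-exactification`, stub S3
# (`stub_layeredMeanSelection`), fault identification package (FI1): the transported competitor
# energy is at least `2e* − C/(2n+1)`

Lead c19, worker W14.  The deterministic per-sample lower bound consumed by the mean fault-exclusion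
argument `SlackRigidityPricedFloorsFaults.lms_faults_ae_zero`: for data `e` fitting the sample `S`
and a nonnegative function `g` on `ℝ³` which, at every pattern point of layer `m`, equals the
COMPETITOR ENERGY of the data re-rooted at layer `m` (plus a constant `K`),

  `g (pointOf e m i j) = Φ₀(a) + Σ'_{m' ≠ 0} Φ(a, z(m'+m) − z m, L_alt m') + K`,

the integral of `g` against the uniform layer transport over the `2n+1` layers around the root
(weight `(1/(2n+1)) Σ_{|m| ≤ n} 1[y ∈ T m]/#(T m)`, `T m = layerTargets e m`) is at least
`ofReal (2e* − C/(2n+1) + K)`, with ONE constant `C ≥ 0`, GIVEN the free window lower bound (L)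
(`SlackRigidityPricedFloorsWindowLower.stub_windowLowerBound`, taken as a hypothesis verbatim as in
`SlackRigidityPricedFloorsWindow.lms_window_sum_ge`).

Proof: the targets `T m ⊆ S` are nonempty, pairwise disjoint finite sets
(`SlackRigidityPricedFloorsIncrIdent.layerTargets_nonempty / _disjoint / _subset_dataSet`) on which `g`
is the constant `c m` = the layer-`m` term of the competitor's window sum
(`SlackRigidityPricedFloorsLayerEnergy.competitorEnergy_reroot`) `+ K`; the counting-measure bookkeeping
`SlackRigidityPricedFloorsIdent.lintegral_avg_ge` reduces the claim to
`Σ_{|m| ≤ n} c m ≥ (2n+1)(2e* + K) − C`, which is the window bound `lms_window_sum_ge` for the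
competitor data `(a, alternatingHagg, z)` on the window `[−n, n] = Ico (−n) (−n + (2n+1))`.
Registered sub-goal `lms_fault_transport_bound`.  All `[folklore]`.
-/

noncomputable section

open MeasureTheory Filter Set
open scoped ENNReal BigOperators Topology

namespace Summit.AtomisticToContinuum.Crystallization.Theorems.SlackRigidityPricedFloorsFaultIdent

open Literature.Probability.Process
open Literature.MathematicalPhysics.StatisticalMechanics
open Summit.AtomisticToContinuum.Crystallization.Theorems.SlackRigidityPricedFloors
open Summit.AtomisticToContinuum.Crystallization.Theorems.SlackRigidityPricedFloorsLayerEnergy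
open Summit.AtomisticToContinuum.Crystallization.Theorems.SlackRigidityPricedFloorsIdent
open Summit.AtomisticToContinuum.Crystallization.Theorems.SlackRigidityPricedFloorsIncrIdent
open Summit.AtomisticToContinuum.Crystallization.Theorems.SlackRigidityPricedFloorsWindow
open Summit.AtomisticToContinuum.Crystallization.Theorems.SlackRigidityPricedFloorsTransport
open Summit.AtomisticToContinuum.Crystallization.Theorems.MinimiserShells.Negative.LoadBearing (eStar)

/-! ## The symmetric window -/

/-- The symmetric window `[−n, n]` as the window `Ico (−n) (−n + (2n+1))` of `lms_window_sum_ge`.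
[folklore] -/
theorem Ico_neg_eq_Icc (n : ℕ) :
    Finset.Ico (-(n : ℤ)) (-(n : ℤ) + ((2 * n + 1 : ℕ) : ℤ)) = Finset.Icc (-(n : ℤ)) n := by
  ext m
  simp only [Finset.mem_Ico, Finset.mem_Icc]
  push_cast
  omega

/-! ## The registered sub-goal -/

/-- **Transported competitor energy bound** (registered sub-goal `lms_fault_transport_bound`): see the
module docstring. [folklore] -/
theorem lms_fault_transport_bound : (∀ δ : ℝ, 0 < δ → ∃ C : ℝ, ∀ S : Set E3, (∀ p ∈ S, ∀ q ∈ S, p ≠ q → δ ≤ dist p q) → ∀ W : Finset E3, (↑W : Set E3) ⊆ S → 2 * groundStateEnergy lennardJones 3 W.card - C * ∑ p ∈ W, (1 + Metric.infDist p (S \ (↑W : Set E3)))⁻¹ ^ 3 ≤ ∑ p ∈ W, (∑' q : {q : E3 // q ∈ S ∧ q ≠ p}, lennardJones (dist p (q : E3)))) → ∃ C : ℝ, 0 ≤ C ∧ ∀ (n : ℕ) (S : Set E3) (e : LData), Fits S e → ∀ (g : E3 → ℝ) (K : ℝ), (∀ y, 0 ≤ g y) → (∀ (m i j : ℤ), g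 (pointOf e m i j) = (inLayerInteraction lennardJones e.2.1 + ∑' m' : ℤ, if m' = 0 then (0 : ℝ) else layerInteraction lennardJones e.2.1 ((rerootData e m).2.2.2 m') (haggLabel alternatingHagg m') 1) + K) → ENNReal.ofReal (2 * eStar - C / (2 * n + 1) + K) ≤ ∫⁻ y, ENNReal.ofReal ((1 / (2 * n + 1)) * ∑ m ∈ Finset.Icc (-(n : ℤ)) n, (if y ∈ layerTargets e m then (1 : ℝ) / (layerTargets e m).card else 0)) * ENNReal.ofReal (g y) ∂((Measure.count : Measure E3).restrict S) := by
  intro hL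
  obtain ⟨C, hC⟩ := lms_window_sum_ge hL
  refine ⟨max C 0, le_max_right _ _, fun n S e he g K hg hgc => ?_⟩
  obtain ⟨⟨hT, hadm, hz0⟩, hS⟩ := he
  have he' : IsNormalData e := ⟨hT, hadm, hz0⟩
  -- adapted from SlackRigidityPricedFloorsIncrIdent.lms_ident_A (the targets satisfy the hypotheses)
  refine lintegral_avg_ge (S := S) (hS ▸ countable_dataSet e) (layerTargets e)
    (fun m => hS ▸ layerTargets_subset_dataSet e m) (layerTargets_nonempty e)
    (fun m m' h => layerTargets_disjoint he' h) n _ g _ (fun y => rfl) hg (const_on_layerTargets hgc) ?_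
  · -- the window bound for the competitor data `(a, alternatingHagg, z)` on `[−n, n]`
    have hw := hC (frameIsometry e.1 hT) e.2.1 alternatingHagg e.2.2.2 hadm.1 hadm.2.1
      (fun m => (hadm.2.2.2 m).1) (-(n : ℤ)) (2 * n + 1)
    rw [Ico_neg_eq_Icc] at hw
    have hcm : ∀ m : ℤ, (inLayerInteraction lennardJones e.2.1 + ∑' m' : ℤ, if m' = 0 then (0 : ℝ) else
        layerInteraction lennardJones e.2.1 ((rerootData e m).2.2.2 m') (haggLabel alternatingHagg m') 1) + K =
        (inLayerInteraction lennardJones e.2.1 + ∑' m' : ℤ, if m' = m then (0 : ℝ) else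
          layerInteraction lennardJones e.2.1 (e.2.2.2 m' - e.2.2.2 m)
            (haggLabel alternatingHagg m' - haggLabel alternatingHagg m) 1) + K := by
      intro m
      simp only [rerootData]
      rw [competitorEnergy_reroot]
    rw [Finset.sum_congr rfl (fun m _ => hcm m), Finset.sum_add_distrib, Finset.sum_const, nsmul_eq_mul,
      card_Icc_neg_nat]
    have hpos : (0 : ℝ) < 2 * n + 1 := by positivity
    have h1 : (2 * (n : ℝ) + 1) * (2 * eStar - max C 0 / (2 * n + 1) + K) =
        2 * (2 * (n : ℝ) + 1) * eStar + (2 * (n : ℝ) + 1) * K - max C 0 := by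
      field_simp
      ring
    rw [h1]
    push_cast at hw ⊢
    have hCm : C ≤ max C 0 := le_max_left _ _
    linarith

end Summit.AtomisticToContinuum.Crystallization.Theorems.SlackRigidityPricedFloorsFaultIdent

end
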